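import Literature.Analysis.FluidPDE.TorusNSChessboardTimeAverages
import HarnessLib

/-!
# The energy-class budget `∫₀ᵀ (∫ |u|²|ω|²)^{1/3} dt` on `T³` (Lamb vector, helicity density,
# "active nonlinearity")

Analysis/FluidPDE proof file (theorems only; no definitions, no named facts).

Search for candidate a priori estimates; no regularity claim. For a classical solution of the
unforced Navier–Stokes equations on `[0, T] × T³` with mean-zero velocity slices, Hölder
(`∫|u|²|ω|² ≤ ‖u‖₆²‖ω‖₃²`), the mean-zero Sobolev inequality `‖u‖₆² ≤ C‖∇u‖₂²`
(Robinson–Rodrigo–Sadowski 2016, Thm 1.7 / tree `Torus.exists_integral_norm_pow_six_le_gradNormSq_cube`),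
`|ω|² ≤ 2|∇u|²`, and the square `(1, 3/2)` of Gibbon's chessboard of time averages
(`∫₀ᵀ‖∇u‖₃ dt` bounded a priori — Gibbon 2019 Thm 2 (i); tree
`Torus.exists_classicalNS_integral_gradSq_rpow_le` at `m = 3/2`) combine, by Hölder in time with
exponents `3, 3/2` against the energy budget `∫₀ᵀ‖∇u‖₂² ≤ E = ‖u₀‖₂²/(2ν)`, to

`∫₀ᵀ (∫ |u|²|ω|² dx)^{1/3} dt ≤ K · Y₁^{1/6} (T + E)^{1/3} E^{1/2}`,
`Y₁ = 1/ν + 27‖u₀‖₂²/(8π⁴ν⁵)`, `K` = a product of the tree's Sobolev constants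

(`Torus.exists_classicalNS_integral_normSq_mul_vorticitySq_rpow_le`). Since
`|ω × u|² ≤ |u|²|ω|²`, `|ℙ(ω × u)|… ≤ …` and `(u·ω)² ≤ |u|²|ω|²` pointwise, the same budget bounds
the Lamb-vector energy `∫|ω × u|²`, the "active nonlinearity" and `∫(u·ω)²` (exponent `1/3` on
each). A combination of printed results in the tree's vocabulary; constants of this proof.

## Mathlib / tree search

Tree (used): `Torus.exists_integral_norm_pow_six_le_gradNormSq_cube`,
`Torus.exists_classicalNS_integral_gradSq_rpow_le` (`TorusNSChessboardTimeAverages`),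
`torusVorticitySqAt_le_two_mul_sum_norm_sq` (`ExtremeGrowthVorticityControl`),
`Torus.classicalNS_integral_gradNormSq_le`, `Torus.IsClassicalNSSolutionOn.hasDerivWithinAt_half_gradNormSq`
(`TorusNSFoiasGuillopeTemam`), `Torus.eventually_norm_sub_lt_of_continuousOn` (tube lemma); Mathlib
`integral_mul_le_Lp_mul_Lq_of_nonneg`. Searched: `normSq_mul_vorticitySq|Lamb|helicityDensity` —
nothing on the torus.

## References

* [Gibbon2019Chessboard] J. D. Gibbon, *Weak and strong solutions of the 3D Navier–Stokes
  equations and their relation to a chessboard of convergent inverse length scales*, J. Nonlinear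
  Sci. 29 (2019) 215–228, Thm 2 (i) (row `n = 1`).
* [RobinsonRodrigoSadowski2016] J. C. Robinson, J. L. Rodrigo, W. Sadowski, *The three-dimensional
  Navier–Stokes equations*, CUP 2016, Thm 1.7 (Sobolev), Lemma 3.5.
-/

noncomputable section

open Set MeasureTheory intervalIntegral Filter Real
open scoped ContDiff InnerProductSpace Topology ENNReal

namespace Literature.Analysis.FluidPDE

open Literature.Analysis.FunctionSpaces

variable {d : Type*} [Fintype d] [DecidableEq d]

/-! ### Tools (private copies): Hölder on `T^d` and on `[0, T]`, tube lemma -/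

omit [DecidableEq d] in
/-- Hölder for continuous nonnegative functions on `T^d` with real conjugate exponents. [folklore] -/
private theorem integral_mul_le_rpow₁₁ {f g : UnitAddTorus d → ℝ} (hf : Continuous f)
    (hg : Continuous g) (hf0 : ∀ x, 0 ≤ f x) (hg0 : ∀ x, 0 ≤ g x) {p q : ℝ}
    (hpq : p.HolderConjugate q) :
    ∫ x, f x * g x ≤ (∫ x, f x ^ p) ^ (1 / p) * (∫ x, g x ^ q) ^ (1 / q) :=
  integral_mul_le_Lp_mul_Lq_of_nonneg (μ := volume) hpq (ae_of_all _ hf0) (ae_of_all _ hg0)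
    (hf.memLp_of_hasCompactSupport (HasCompactSupport.of_compactSpace f))
    (hg.memLp_of_hasCompactSupport (HasCompactSupport.of_compactSpace g))

omit [Fintype d] [DecidableEq d] in
/-- Hölder on `[0, T]` for functions continuous on `[0, T]` and nonnegative there. [folklore] -/
private theorem intervalIntegral_mul_le_rpow₁₁ {f g : ℝ → ℝ} {T : ℝ} (hT : 0 ≤ T)
    (hf : ContinuousOn f (Icc 0 T)) (hg : ContinuousOn g (Icc 0 T))
    (hf0 : ∀ t ∈ Icc 0 T, 0 ≤ f t) (hg0 : ∀ t ∈ Icc 0 T, 0 ≤ g t) {p q : ℝ}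
    (hpq : p.HolderConjugate q) :
    ∫ t in (0 : ℝ)..T, f t * g t ≤
      (∫ t in (0 : ℝ)..T, f t ^ p) ^ (1 / p) * (∫ t in (0 : ℝ)..T, g t ^ q) ^ (1 / q) := by
  simp only [intervalIntegral.integral_of_le hT]
  have hae : ∀ {φ : ℝ → ℝ}, (∀ t ∈ Icc 0 T, 0 ≤ φ t) → 0 ≤ᵐ[volume.restrict (Ioc 0 T)] φ :=
    fun h0 => (ae_restrict_iff' measurableSet_Ioc).2 (ae_of_all _ fun t ht => h0 t (Ioc_subset_Icc_self ht))
  have hmem : ∀ {φ : ℝ → ℝ}, ContinuousOn φ (Icc 0 T) → ∀ r : ℝ≥0∞,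
      MemLp φ r (volume.restrict (Ioc 0 T)) := by
    intro φ hφ r
    have hm : AEStronglyMeasurable φ (volume.restrict (Ioc 0 T)) :=
      (hφ.mono Ioc_subset_Icc_self).aestronglyMeasurable measurableSet_Ioc
    obtain ⟨C, hC⟩ := isCompact_Icc.exists_bound_of_continuousOn hφ
    exact (memLp_top_of_bound hm C ((ae_restrict_iff' measurableSet_Ioc).2
      (ae_of_all _ fun t ht => hC t (Ioc_subset_Icc_self ht)))).mono_exponent le_top
  exact integral_mul_le_Lp_mul_Lq_of_nonneg hpq (hae hf0) (hae hg0) (hmem hf _) (hmem hg _)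

omit [DecidableEq d] in
/-- Continuity of `t ↦ ∫ φ(t, x) dx` on `S` for `φ` with continuous space–time lift (tube lemma
on the compact torus). [folklore] -/
private theorem continuousOn_integral_of_continuousOn_stLift₁₁ {S : Set ℝ}
    {φ : ℝ → UnitAddTorus d → ℝ} (hφ : ContinuousOn (Torus.stLift φ) (S ×ˢ univ))
    (hsl : ∀ t ∈ S, Continuous (φ t)) : ContinuousOn (fun t => ∫ x, φ t x) S := by
  intro t ht
  rw [ContinuousWithinAt, Metric.tendsto_nhds]
  intro ε hε
  have h := Torus.eventually_norm_sub_lt_of_continuousOn hφ ht (half_pos hε)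
  filter_upwards [h, self_mem_nhdsWithin] with s hs hsS
  have his : Integrable (φ s) := (hsl s hsS).integrable_unitAddTorus
  have hit : Integrable (φ t) := (hsl t ht).integrable_unitAddTorus
  rw [Real.dist_eq, ← integral_sub his hit]
  calc |∫ x, (φ s x - φ t x)| ≤ ∫ x, |φ s x - φ t x| := MeasureTheory.abs_integral_le_integral_abs
    _ ≤ ∫ _x : UnitAddTorus d, ε / 2 := by
        refine integral_mono_of_nonneg (ae_of_all _ fun x => abs_nonneg _) (integrable_const _)
          (ae_of_all _ fun x => ?_)
        have h1 := hs x
        rw [Real.norm_eq_abs] at h1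
        exact h1.le
    _ = ε / 2 := by simp
    _ < ε := half_lt_self hε

/-- `|ω|²` of a smooth field is continuous. [folklore] -/
private theorem continuous_Q₁₁ {v : UnitAddTorus d → EuclideanSpace ℝ d} (hv : Torus.IsSmooth v) :
    Continuous (torusVorticitySqAt v) := by
  have hD : ∀ i j, Continuous (fun y => Torus.partialDeriv i v y j) :=
    fun i j => ((hv.partialDeriv i).apply j).continuous
  have : Continuous (fun x => (2⁻¹ : ℝ) * ∑ i, ∑ j,
      (Torus.partialDeriv i v x j - Torus.partialDeriv j v x i) ^ 2) :=
    continuous_const.mul (continuous_finsetSum _ fun i _ => continuous_finsetSum _ fun j _ =>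
      ((hD i j).sub (hD j i)).pow 2)
  exact this

/-- `|ω(u(s))|²` is jointly smooth along a jointly smooth `u`. [folklore] -/
private theorem isSmoothSpaceTimeOn_Q₁₁ {a b : ℝ}
    {u : ℝ → UnitAddTorus d → EuclideanSpace ℝ d} (hu : Torus.IsSmoothSpaceTimeOn (Icc a b) u)
    (hab : a < b) :
    Torus.IsSmoothSpaceTimeOn (Icc a b) (fun s y => torusVorticitySqAt (u s) y) := by
  have hU : UniqueDiffOn ℝ (Icc a b) := uniqueDiffOn_Icc hab
  have hW : ∀ i j, Torus.IsSmoothSpaceTimeOn (Icc a b)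
      (fun s y => Torus.partialDeriv i (u s) y j - Torus.partialDeriv j (u s) y i) :=
    fun i j => ((hu.partialDeriv hU i).apply j).sub ((hu.partialDeriv hU j).apply i)
  have h : ∀ i j, Torus.IsSmoothSpaceTimeOn (Icc a b)
      (fun s y => (Torus.partialDeriv i (u s) y j - Torus.partialDeriv j (u s) y i) *
        (Torus.partialDeriv i (u s) y j - Torus.partialDeriv j (u s) y i)) :=
    fun i j => (hW i j).mul (hW i j)
  have hs := Torus.IsSmoothSpaceTimeOn.sum (s := Finset.univ) fun i (_ : i ∈ Finset.univ) =>
    Torus.IsSmoothSpaceTimeOn.sum (s := Finset.univ) fun j (_ : j ∈ Finset.univ) => h i j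
  have hfun : (fun s y => torusVorticitySqAt (u s) y) = fun s y => (2⁻¹ : ℝ) •
      ∑ i, ∑ j, (Torus.partialDeriv i (u s) y j - Torus.partialDeriv j (u s) y i) *
        (Torus.partialDeriv i (u s) y j - Torus.partialDeriv j (u s) y i) := by
    funext s y
    simp only [torusVorticitySqAt, smul_eq_mul, sq]
  rw [hfun]
  exact hs.const_smul (2⁻¹ : ℝ)

/-! ### The pointwise-in-time estimate `∫|u|²|ω|² ≤ 2 C₆^{1/3} ‖∇u‖₂² (∫|∇u|³)^{2/3}` -/

/-- **`∫|u|²|ω|² ≤ 2C^{1/3} ‖∇u‖₂² (∫|∇u|³)^{2/3}` for smooth mean-zero `u` on `T³`** (Hölder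
`∫|u|²|ω|² ≤ ‖u‖₆²‖ω‖₃²`, Sobolev `∫|u|⁶ ≤ C‖∇u‖₂⁶`, `|ω|² ≤ 2|∇u|²`, `|∇u|² = ∑ᵢ‖∂ᵢu‖²`);
`C` is the tree's Sobolev constant. [cite: RobinsonRodrigoSadowski2016, Thm 1.7 and Lemma 3.5] -/
theorem Torus.exists_integral_normSq_mul_vorticitySq_le (hd : Fintype.card d = 3) :
    ∃ C : ℝ, 0 ≤ C ∧ ∀ v : UnitAddTorus d → EuclideanSpace ℝ d, Torus.IsSmooth v →
      Torus.HasZeroMean v →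
        ∫ x, ‖v x‖ ^ 2 * torusVorticitySqAt v x ≤
          C * Torus.gradNormSq v * (∫ x, (∑ i, ‖Torus.partialDeriv i v x‖ ^ 2) ^ ((3 : ℝ) / 2)) ^
            ((2 : ℝ) / 3) := by
  obtain ⟨C₆, hC₆0, hC₆⟩ := Torus.exists_integral_norm_pow_six_le_gradNormSq_cube (d := d) hd
  refine ⟨2 * C₆ ^ ((1 : ℝ) / 3), by positivity, fun v hv hv0 => ?_⟩
  have hQc : Continuous (torusVorticitySqAt v) := continuous_Q₁₁ hv
  have hGc : Continuous (fun x => ∑ i, ‖Torus.partialDeriv i v x‖ ^ 2) :=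
    continuous_finsetSum _ fun i _ => (hv.partialDeriv i).continuous.norm.pow 2
  have hQ0 : ∀ x, 0 ≤ torusVorticitySqAt v x := fun x => torusVorticitySqAt_nonneg v x
  have hG0 : ∀ x, 0 ≤ ∑ i, ‖Torus.partialDeriv i v x‖ ^ 2 := fun x =>
    Finset.sum_nonneg fun i _ => sq_nonneg _
  -- Hölder with exponents `3` and `3/2`
  have hpq : (3 : ℝ).HolderConjugate (3 / 2) := Real.holderConjugate_iff.2 ⟨by norm_num, by norm_num⟩
  have hH := integral_mul_le_rpow₁₁ (hv.continuous.norm.pow 2) hQc (fun x => sq_nonneg _) hQ0 hpq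
  -- `(∫(‖v‖²)³)^{1/3} = (∫‖v‖⁶)^{1/3} ≤ (C₆ G³)^{1/3} = C₆^{1/3} G`
  have e6 : ∫ x, (‖v x‖ ^ 2) ^ (3 : ℝ) = ∫ x, ‖v x‖ ^ 6 :=
    integral_congr_ae (ae_of_all _ fun x => by
      dsimp only
      rw [show (3 : ℝ) = ((3 : ℕ) : ℝ) by norm_num, Real.rpow_natCast]; ring)
  have hG : 0 ≤ Torus.gradNormSq v := Torus.gradNormSq_nonneg v
  have h1 : (∫ x, (‖v x‖ ^ 2) ^ (3 : ℝ)) ^ (1 / (3 : ℝ)) ≤ C₆ ^ ((1 : ℝ) / 3) * Torus.gradNormSq v := by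
    rw [e6]
    have h6 := hC₆ v hv hv0
    have h60 : 0 ≤ ∫ x, ‖v x‖ ^ 6 := integral_nonneg fun x => by positivity
    calc (∫ x, ‖v x‖ ^ 6) ^ (1 / (3 : ℝ)) ≤ (C₆ * Torus.gradNormSq v ^ 3) ^ (1 / (3 : ℝ)) :=
          Real.rpow_le_rpow h60 h6 (by norm_num)
      _ = C₆ ^ ((1 : ℝ) / 3) * Torus.gradNormSq v := by
          rw [Real.mul_rpow hC₆0 (by positivity), show ((1 : ℝ) / 3) = 1 / (3 : ℝ) by norm_num,
            show (Torus.gradNormSq v ^ 3) = Torus.gradNormSq v ^ (3 : ℝ) by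
              rw [show (3 : ℝ) = ((3 : ℕ) : ℝ) by norm_num, Real.rpow_natCast],
            ← Real.rpow_mul hG, show (3 : ℝ) * (1 / 3) = 1 by norm_num, Real.rpow_one]
  -- `(∫ Q^{3/2})^{2/3} ≤ (∫ (2G)^{3/2})^{2/3} = 2 (∫ G^{3/2})^{2/3}`
  have h2 : (∫ x, torusVorticitySqAt v x ^ ((3 : ℝ) / 2)) ^ (1 / ((3 : ℝ) / 2)) ≤
      2 * (∫ x, (∑ i, ‖Torus.partialDeriv i v x‖ ^ 2) ^ ((3 : ℝ) / 2)) ^ ((2 : ℝ) / 3) := by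
    have hpt : ∀ x, torusVorticitySqAt v x ^ ((3 : ℝ) / 2) ≤
        (2 : ℝ) ^ ((3 : ℝ) / 2) * (∑ i, ‖Torus.partialDeriv i v x‖ ^ 2) ^ ((3 : ℝ) / 2) := by
      intro x
      rw [← Real.mul_rpow (by norm_num) (hG0 x)]
      exact Real.rpow_le_rpow (hQ0 x) (torusVorticitySqAt_le_two_mul_sum_norm_sq v x) (by norm_num)
    have iQ : Integrable (fun x => torusVorticitySqAt v x ^ ((3 : ℝ) / 2)) :=
      (hQc.rpow_const fun x => Or.inr (by norm_num)).integrable_unitAddTorus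
    have iG : Integrable (fun x => (2 : ℝ) ^ ((3 : ℝ) / 2) *
        (∑ i, ‖Torus.partialDeriv i v x‖ ^ 2) ^ ((3 : ℝ) / 2)) :=
      (continuous_const.mul (hGc.rpow_const fun x => Or.inr (by norm_num))).integrable_unitAddTorus
    have hmono := integral_mono iQ iG hpt
    rw [MeasureTheory.integral_const_mul] at hmono
    have hI0 : 0 ≤ ∫ x, torusVorticitySqAt v x ^ ((3 : ℝ) / 2) :=
      integral_nonneg fun x => Real.rpow_nonneg (hQ0 x) _
    have hJ0 : 0 ≤ ∫ x, (∑ i, ‖Torus.partialDeriv i v x‖ ^ 2) ^ ((3 : ℝ) / 2) :=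
      integral_nonneg fun x => Real.rpow_nonneg (hG0 x) _
    rw [show 1 / ((3 : ℝ) / 2) = (2 : ℝ) / 3 by norm_num]
    calc (∫ x, torusVorticitySqAt v x ^ ((3 : ℝ) / 2)) ^ ((2 : ℝ) / 3)
        ≤ ((2 : ℝ) ^ ((3 : ℝ) / 2) * ∫ x, (∑ i, ‖Torus.partialDeriv i v x‖ ^ 2) ^ ((3 : ℝ) / 2)) ^
            ((2 : ℝ) / 3) := Real.rpow_le_rpow hI0 hmono (by norm_num)
      _ = 2 * (∫ x, (∑ i, ‖Torus.partialDeriv i v x‖ ^ 2) ^ ((3 : ℝ) / 2)) ^ ((2 : ℝ) / 3) := by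
          rw [Real.mul_rpow (by positivity) hJ0, ← Real.rpow_mul (by norm_num),
            show (3 : ℝ) / 2 * (2 / 3) = 1 by norm_num, Real.rpow_one]
  have hA0 : 0 ≤ (∫ x, (‖v x‖ ^ 2) ^ (3 : ℝ)) ^ (1 / (3 : ℝ)) :=
    Real.rpow_nonneg (integral_nonneg fun x => Real.rpow_nonneg (sq_nonneg _) _) _
  have hB0 : 0 ≤ (∫ x, torusVorticitySqAt v x ^ ((3 : ℝ) / 2)) ^ (1 / ((3 : ℝ) / 2)) :=
    Real.rpow_nonneg (integral_nonneg fun x => Real.rpow_nonneg (hQ0 x) _) _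
  calc ∫ x, ‖v x‖ ^ 2 * torusVorticitySqAt v x
      ≤ (∫ x, (‖v x‖ ^ 2) ^ (3 : ℝ)) ^ (1 / (3 : ℝ)) *
          (∫ x, torusVorticitySqAt v x ^ ((3 : ℝ) / 2)) ^ (1 / ((3 : ℝ) / 2)) := hH
    _ ≤ (C₆ ^ ((1 : ℝ) / 3) * Torus.gradNormSq v) *
          (2 * (∫ x, (∑ i, ‖Torus.partialDeriv i v x‖ ^ 2) ^ ((3 : ℝ) / 2)) ^ ((2 : ℝ) / 3)) :=
        mul_le_mul h1 h2 hB0 (by positivity)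
    _ = 2 * C₆ ^ ((1 : ℝ) / 3) * Torus.gradNormSq v *
          (∫ x, (∑ i, ‖Torus.partialDeriv i v x‖ ^ 2) ^ ((3 : ℝ) / 2)) ^ ((2 : ℝ) / 3) := by ring

/-! ### The budget -/

/-- **Energy-class budget `∫₀ᵀ (∫|u|²|ω|²)^{1/3} dt` on `T³`** (Hölder–Sobolev as in
`Torus.exists_integral_normSq_mul_vorticitySq_le`, then Hölder in time with exponents `3, 3/2`
against `∫₀ᵀ‖∇u‖₂² ≤ E` and the chessboard square `(1, 3/2)`, `∫₀ᵀ(∫|∇u|³)^{1/3} ≤ K₁Y₁^{1/4}(T+E)^{1/2}E^{1/4}`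
— Gibbon 2019 Thm 2 (i), tree `Torus.exists_classicalNS_integral_gradSq_rpow_le`): for `card d = 3`
there is `K ≥ 0` such that along every classical solution of the unforced Navier–Stokes equations
with `ν > 0` on `[0, T] × T^d` with mean-zero velocity slices (`E₀ = ‖u(0)‖₂²`, `E = E₀/(2ν)`,
`Y₁ = 1/ν + 27E₀/(8π⁴ν⁵)`),

`∫₀ᵀ (∫ |u(t,x)|² |ω(t,x)|² dx)^{1/3} dt ≤ K · Y₁^{1/6} · (T + E)^{1/3} · E^{1/2}`.

Pointwise `|ω × u|² ≤ |u|²|ω|²` and `(u·ω)² ≤ |u|²|ω|²`, so the same bound holds for the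
Lamb-vector energy and for `∫(u·ω)²`. A combination of printed results; constants of this proof.
[cite: Gibbon2019Chessboard, Theorem 2 (i) (row n = 1, m = 3/2)]
[cite: RobinsonRodrigoSadowski2016, Thm 1.7 and Lemma 3.5] -/
theorem Torus.exists_classicalNS_integral_normSq_mul_vorticitySq_rpow_le (hd : Fintype.card d = 3) :
    ∃ K : ℝ, 0 ≤ K ∧ ∀ {ν T : ℝ}, 0 < ν → 0 < T →
      ∀ {u : ℝ → UnitAddTorus d → EuclideanSpace ℝ d} {p : ℝ → UnitAddTorus d → ℝ},
        Torus.IsClassicalNSSolutionOn (Icc 0 T) ν 0 u p →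
        (∀ t ∈ Icc 0 T, Torus.HasZeroMean (u t)) →
        ∫ t in (0 : ℝ)..T, (∫ x, ‖u t x‖ ^ 2 * torusVorticitySqAt (u t) x) ^ ((1 : ℝ) / 3) ≤
          K * (1 / ν + 27 * (∫ x, ‖u 0 x‖ ^ 2) / (8 * π ^ 4 * ν ^ 5)) ^ ((1 : ℝ) / 6) *
            (T + (∫ x, ‖u 0 x‖ ^ 2) / (2 * ν)) ^ ((1 : ℝ) / 3) *
            ((∫ x, ‖u 0 x‖ ^ 2) / (2 * ν)) ^ ((1 : ℝ) / 2) := by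
  obtain ⟨C, hC0, hC⟩ := Torus.exists_integral_normSq_mul_vorticitySq_le (d := d) hd
  obtain ⟨K₁, hK₁0, hK₁⟩ := Torus.exists_classicalNS_integral_gradSq_rpow_le (d := d) hd
    (m := 3 / 2) (by norm_num) (by norm_num)
  refine ⟨C ^ ((1 : ℝ) / 3) * K₁ ^ ((2 : ℝ) / 3), by positivity, fun {ν T} hν hT {u p} h hmean => ?_⟩
  have hU : UniqueDiffOn ℝ (Icc 0 T) := uniqueDiffOn_Icc hT
  set E₀ : ℝ := ∫ x, ‖u 0 x‖ ^ 2 with hE₀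
  set Y₁ : ℝ := 1 / ν + 27 * E₀ / (8 * π ^ 4 * ν ^ 5) with hY₁
  set E : ℝ := E₀ / (2 * ν) with hE
  have hE₀0 : 0 ≤ E₀ := integral_nonneg fun x => sq_nonneg _
  have hE0 : 0 ≤ E := by positivity
  have hY0 : 0 ≤ Y₁ := by positivity
  -- names
  obtain ⟨g, hg⟩ : ∃ g : ℝ → ℝ, ∀ τ, g τ = Torus.gradNormSq (u τ) := ⟨_, fun _ => rfl⟩
  obtain ⟨G, hG⟩ : ∃ G : ℝ → ℝ, ∀ τ, G τ =
      ∫ x, (∑ i, ‖Torus.partialDeriv i (u τ) x‖ ^ 2) ^ ((3 : ℝ) / 2) := ⟨_, fun _ => rfl⟩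
  obtain ⟨X, hX⟩ : ∃ X : ℝ → ℝ, ∀ τ, X τ = ∫ x, ‖u τ x‖ ^ 2 * torusVorticitySqAt (u τ) x :=
    ⟨_, fun _ => rfl⟩
  have hus : ∀ τ ∈ Icc 0 T, Torus.IsSmooth (u τ) := fun τ hτ => h.smooth_velocity.isSmooth_slice hτ
  have hg0 : ∀ τ, 0 ≤ g τ := fun τ => by rw [hg]; exact Torus.gradNormSq_nonneg _
  have hG0 : ∀ τ, 0 ≤ G τ := fun τ => by
    rw [hG]; exact integral_nonneg fun x => Real.rpow_nonneg (Finset.sum_nonneg fun i _ => sq_nonneg _) _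
  have hX0 : ∀ τ, 0 ≤ X τ := fun τ => by
    rw [hX]; exact integral_nonneg fun x => mul_nonneg (sq_nonneg _) (torusVorticitySqAt_nonneg _ _)
  -- Step 1: pointwise in time, `X^{1/3} ≤ C^{1/3} g^{1/3} G^{2/9}`
  have hstep : ∀ τ ∈ Icc 0 T, X τ ^ ((1 : ℝ) / 3) ≤
      C ^ ((1 : ℝ) / 3) * (g τ ^ ((1 : ℝ) / 3) * (G τ ^ ((1 : ℝ) / 3)) ^ ((2 : ℝ) / 3)) := by
    intro τ hτ
    have h1 := hC (u τ) (hus τ hτ) (hmean τ hτ)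
    rw [← hX, ← hg, ← hG] at h1
    have h2 := Real.rpow_le_rpow (hX0 τ) h1 (by norm_num : (0 : ℝ) ≤ 1 / 3)
    refine h2.trans (le_of_eq ?_)
    rw [Real.mul_rpow (mul_nonneg hC0 (hg0 τ)) (Real.rpow_nonneg (hG0 τ) _),
      Real.mul_rpow hC0 (hg0 τ), ← Real.rpow_mul (hG0 τ), ← Real.rpow_mul (hG0 τ)]
    norm_num
    ring
  -- Step 2: continuity in time of `X`, `g`, `G`
  have hgc : ContinuousOn g (Icc 0 T) := by
    rw [show g = fun τ => Torus.gradNormSq (u τ) from funext hg]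
    intro t ht
    have h1 : ContinuousWithinAt (fun s => (2 : ℝ) * (2⁻¹ * Torus.gradNormSq (u s))) (Icc 0 T) t :=
      continuousWithinAt_const.mul (h.hasDerivWithinAt_half_gradNormSq hT ht).continuousWithinAt
    refine h1.congr (fun s _ => ?_) ?_ <;> ring
  have hDst : ∀ i, ContinuousOn (Torus.stLift (fun t => Torus.partialDeriv i (u t))) (Icc 0 T ×ˢ univ) :=
    fun i => (h.smooth_velocity.partialDeriv hU i).continuousOn_stLift
  have hust : ContinuousOn (Torus.stLift u) (Icc 0 T ×ˢ univ) := h.smooth_velocity.continuousOn_stLift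
  have hGc : ContinuousOn G (Icc 0 T) := by
    rw [show G = fun τ => ∫ x, (∑ i, ‖Torus.partialDeriv i (u τ) x‖ ^ 2) ^ ((3 : ℝ) / 2) from funext hG]
    refine continuousOn_integral_of_continuousOn_stLift₁₁
      (φ := fun τ x => (∑ i, ‖Torus.partialDeriv i (u τ) x‖ ^ 2) ^ ((3 : ℝ) / 2)) ?_ fun τ hτ => ?_
    · have e' : Torus.stLift (fun τ x => (∑ i, ‖Torus.partialDeriv i (u τ) x‖ ^ 2) ^ ((3 : ℝ) / 2)) =
          fun z => (∑ i, ‖Torus.stLift (fun t => Torus.partialDeriv i (u t)) z‖ ^ 2) ^ ((3 : ℝ) / 2) := rfl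
      rw [e']
      exact (continuousOn_finsetSum _ fun i _ => ((hDst i).norm).pow 2).rpow_const
        fun z _ => Or.inr (by norm_num)
    · exact (continuous_finsetSum _ fun i _ =>
        ((hus τ hτ).partialDeriv i).continuous.norm.pow 2).rpow_const fun x => Or.inr (by norm_num)
  have hXc : ContinuousOn X (Icc 0 T) := by
    rw [show X = fun τ => ∫ x, ‖u τ x‖ ^ 2 * torusVorticitySqAt (u τ) x from funext hX]
    refine continuousOn_integral_of_continuousOn_stLift₁₁
      (φ := fun τ x => ‖u τ x‖ ^ 2 * torusVorticitySqAt (u τ) x) ?_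
      fun τ hτ => ((hus τ hτ).continuous.norm.pow 2).mul (continuous_Q₁₁ (hus τ hτ))
    have cQst : ContinuousOn (Torus.stLift (fun s y => torusVorticitySqAt (u s) y)) (Icc 0 T ×ˢ univ) :=
      (isSmoothSpaceTimeOn_Q₁₁ h.smooth_velocity hT).continuousOn_stLift
    have e' : Torus.stLift (fun τ x => ‖u τ x‖ ^ 2 * torusVorticitySqAt (u τ) x) =
        fun z => ‖Torus.stLift u z‖ ^ 2 * Torus.stLift (fun s y => torusVorticitySqAt (u s) y) z := by
      funext z; rfl
    rw [e']
    exact (hust.norm.pow 2).mul cQst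
  -- Step 3: Hölder in time with exponents `3`, `3/2`
  have hpq : (3 : ℝ).HolderConjugate (3 / 2) := Real.holderConjugate_iff.2 ⟨by norm_num, by norm_num⟩
  have huIcc : uIcc 0 T = Icc 0 T := uIcc_of_le hT.le
  have hXi : IntervalIntegrable (fun τ => X τ ^ ((1 : ℝ) / 3)) volume 0 T :=
    ((hXc.rpow_const fun τ _ => Or.inr (by norm_num)).mono (by rw [huIcc])).intervalIntegrable
  have hRc : ContinuousOn (fun τ => C ^ ((1 : ℝ) / 3) *
      (g τ ^ ((1 : ℝ) / 3) * (G τ ^ ((1 : ℝ) / 3)) ^ ((2 : ℝ) / 3))) (Icc 0 T) :=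
    continuousOn_const.mul ((hgc.rpow_const fun τ _ => Or.inr (by norm_num)).mul
      ((hGc.rpow_const fun τ _ => Or.inr (by norm_num)).rpow_const fun τ _ => Or.inr (by norm_num)))
  have hRi := (hRc.mono (by rw [huIcc])).intervalIntegrable (μ := volume)
  have hI1 := intervalIntegral.integral_mono_on hT.le hXi hRi hstep
  have hH := intervalIntegral_mul_le_rpow₁₁ hT.le
    (hgc.rpow_const (p := (1 : ℝ) / 3) fun τ _ => Or.inr (by norm_num))
    ((hGc.rpow_const (p := (1 : ℝ) / 3) fun τ _ => Or.inr (by norm_num)).rpow_const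
      (p := (2 : ℝ) / 3) fun τ _ => Or.inr (by norm_num))
    (fun τ _ => Real.rpow_nonneg (hg0 τ) _)
    (fun τ _ => Real.rpow_nonneg (Real.rpow_nonneg (hG0 τ) _) _) hpq
  have eg : (∫ τ in (0 : ℝ)..T, (g τ ^ ((1 : ℝ) / 3)) ^ (3 : ℝ)) = ∫ τ in (0 : ℝ)..T, g τ := by
    refine intervalIntegral.integral_congr fun τ _ => ?_
    show (g τ ^ ((1 : ℝ) / 3)) ^ (3 : ℝ) = g τ
    rw [← Real.rpow_mul (hg0 τ)]; norm_num
  have eG : (∫ τ in (0 : ℝ)..T, ((G τ ^ ((1 : ℝ) / 3)) ^ ((2 : ℝ) / 3)) ^ ((3 : ℝ) / 2)) =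
      ∫ τ in (0 : ℝ)..T, G τ ^ ((1 : ℝ) / 3) := by
    refine intervalIntegral.integral_congr fun τ _ => ?_
    show ((G τ ^ ((1 : ℝ) / 3)) ^ ((2 : ℝ) / 3)) ^ ((3 : ℝ) / 2) = G τ ^ ((1 : ℝ) / 3)
    rw [← Real.rpow_mul (Real.rpow_nonneg (hG0 τ) _)]; norm_num
  rw [eg, eG] at hH
  -- Step 4: the two budgets
  have hgI : (∫ τ in (0 : ℝ)..T, g τ) ≤ E := by
    have := Torus.classicalNS_integral_gradNormSq_le hν hT h
    rw [show (fun t => Torus.gradNormSq (u t)) = g from (funext hg).symm] at this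
    exact this
  have hGI : (∫ τ in (0 : ℝ)..T, G τ ^ ((1 : ℝ) / 3)) ≤
      K₁ * Y₁ ^ ((1 : ℝ) / 4) * (T + E) ^ ((1 : ℝ) / 2) * E ^ ((1 : ℝ) / 4) := by
    have hch := hK₁ hν hT h hmean
    have e1 : (fun t => (∫ x, (∑ j, ‖Torus.partialDeriv j (u t) x‖ ^ 2) ^ ((3 : ℝ) / 2)) ^
        (1 / (4 * ((3 : ℝ) / 2) - 3))) = fun t => G t ^ ((1 : ℝ) / 3) := by
      funext t; rw [hG]; norm_num
    rw [e1] at hch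
    have ea : (3 * ((3 : ℝ) / 2 - 1) / (2 * (4 * ((3 : ℝ) / 2) - 3))) = (1 : ℝ) / 4 := by norm_num
    have eb : (3 * ((3 : ℝ) / 2 - 1) / (4 * ((3 : ℝ) / 2) - 3)) = (1 : ℝ) / 2 := by norm_num
    have ec : ((3 - (3 : ℝ) / 2) / (2 * (4 * ((3 : ℝ) / 2) - 3))) = (1 : ℝ) / 4 := by norm_num
    rw [ea, eb, ec] at hch
    exact hch
  have hgI0 : 0 ≤ ∫ τ in (0 : ℝ)..T, g τ := intervalIntegral.integral_nonneg hT.le fun τ _ => hg0 τ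
  have hGI0 : 0 ≤ ∫ τ in (0 : ℝ)..T, G τ ^ ((1 : ℝ) / 3) :=
    intervalIntegral.integral_nonneg hT.le fun τ _ => Real.rpow_nonneg (hG0 τ) _
  -- conclusion
  rw [show (fun t => (∫ x, ‖u t x‖ ^ 2 * torusVorticitySqAt (u t) x) ^ ((1 : ℝ) / 3)) =
      fun t => X t ^ ((1 : ℝ) / 3) from funext fun t => by rw [hX]]
  calc (∫ τ in (0 : ℝ)..T, X τ ^ ((1 : ℝ) / 3))
      ≤ ∫ τ in (0 : ℝ)..T, C ^ ((1 : ℝ) / 3) * (g τ ^ ((1 : ℝ) / 3) * (G τ ^ ((1 : ℝ) / 3)) ^ ((2 : ℝ) / 3)) := hI1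
    _ = C ^ ((1 : ℝ) / 3) * ∫ τ in (0 : ℝ)..T, g τ ^ ((1 : ℝ) / 3) * (G τ ^ ((1 : ℝ) / 3)) ^ ((2 : ℝ) / 3) :=
        intervalIntegral.integral_const_mul _ _
    _ ≤ C ^ ((1 : ℝ) / 3) * ((∫ τ in (0 : ℝ)..T, g τ) ^ (1 / (3 : ℝ)) *
          (∫ τ in (0 : ℝ)..T, G τ ^ ((1 : ℝ) / 3)) ^ (1 / ((3 : ℝ) / 2))) :=
        mul_le_mul_of_nonneg_left hH (by positivity)
    _ ≤ C ^ ((1 : ℝ) / 3) * (E ^ (1 / (3 : ℝ)) *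
          (K₁ * Y₁ ^ ((1 : ℝ) / 4) * (T + E) ^ ((1 : ℝ) / 2) * E ^ ((1 : ℝ) / 4)) ^ (1 / ((3 : ℝ) / 2))) := by
        refine mul_le_mul_of_nonneg_left (mul_le_mul (Real.rpow_le_rpow hgI0 hgI (by norm_num))
          (Real.rpow_le_rpow hGI0 hGI (by norm_num)) (Real.rpow_nonneg hGI0 _)
          (Real.rpow_nonneg hE0 _)) (by positivity)
    _ = C ^ ((1 : ℝ) / 3) * K₁ ^ ((2 : ℝ) / 3) * Y₁ ^ ((1 : ℝ) / 6) * (T + E) ^ ((1 : ℝ) / 3) *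
          E ^ ((1 : ℝ) / 2) := by
        have hTE : 0 ≤ T + E := by positivity
        rw [show 1 / ((3 : ℝ) / 2) = (2 : ℝ) / 3 by norm_num,
          Real.mul_rpow (by positivity) (Real.rpow_nonneg hE0 _),
          Real.mul_rpow (by positivity) (Real.rpow_nonneg hTE _),
          Real.mul_rpow hK₁0 (Real.rpow_nonneg hY0 _),
          ← Real.rpow_mul hY0, ← Real.rpow_mul hTE, ← Real.rpow_mul hE0]
        norm_num
        have eE : E ^ (1 / (3 : ℝ)) * E ^ ((1 : ℝ) / 6) = E ^ ((1 : ℝ) / 2) := by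
          rw [← Real.rpow_add' hE0 (by norm_num)]; norm_num
        calc C ^ ((1 : ℝ) / 3) * (E ^ (1 / (3 : ℝ)) * (K₁ ^ ((2 : ℝ) / 3) * Y₁ ^ ((1 : ℝ) / 6) *
              (T + E) ^ ((1 : ℝ) / 3) * E ^ ((1 : ℝ) / 6)))
            = C ^ ((1 : ℝ) / 3) * K₁ ^ ((2 : ℝ) / 3) * Y₁ ^ ((1 : ℝ) / 6) * (T + E) ^ ((1 : ℝ) / 3) *
                (E ^ (1 / (3 : ℝ)) * E ^ ((1 : ℝ) / 6)) := by ring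
          _ = _ := by rw [eE]

end Literature.Analysis.FluidPDE

end
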